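import Mathlib.Analysis.Calculus.Deriv.MeanValue
import Mathlib.MeasureTheory.Measure.Lebesgue.Basic
import Mathlib.Analysis.SpecialFunctions.Pow.Real
import HarnessLib

/-!
# Sublevel set estimates of van der Corput type, orders one and two

Topic `Literature/Analysis/Fourier` (companion of `VanDerCorput.lean`, the oscillatory-integral form).
The classical one-dimensional **sublevel set estimates** (Carbery–Christ–Wright, JAMS 12 (1999), §1;
the measure-theoretic counterpart of van der Corput's lemma, Stein, *Harmonic Analysis*, Ch. VIII §1.2):
if `|u^{(k)}| ≥ λ > 0` on an interval `I` then `|{x ∈ I : |u(x)| ≤ t}| ≤ C_k (t/λ)^{1/k}`. We prove the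
two lowest orders with explicit constants, in the hypothesis style of Mathlib's mean value
inequalities (`Convex.mul_sub_le_image_sub_of_le_deriv`):

* `volume_sublevel_le_of_expansive` — derivative-free core: if `g|u-v| ≤ |ξ u - ξ v|` on a set `s`
  (`g > 0`) then `volume {u ∈ s | |ξ u| ≤ t} ≤ 2t/g` (the sublevel set has diameter `≤ 2t/g`);
* `volume_sublevel_Icc_le_of_deriv_ge` / `…_of_deriv_le` — **order one**, `C₁ = 2`: `ξ` continuous
  on `[a,b]`, differentiable inside with `ξ' ≥ g` (resp. `ξ' ≤ -g`), `g > 0` ⟹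
  `volume {u ∈ [a,b] | |ξ u| ≤ t} ≤ 2t/g`;
* `volume_sublevel_Icc_le_of_second_deriv_ge` — **order two** with constant `6`: `ξ` differentiable
  on `[a,b]` with derivative `ξ'` continuous on `[a,b]`, differentiable inside with `(ξ')' ≥ δ > 0`
  ⟹ `volume {u ∈ [a,b] | |ξ u| ≤ t} ≤ 6√(t/δ)` for `t > 0` (split `[a,b]` into `|ξ'| ≤ γ`, of
  measure `≤ 2γ/δ` by order one for `ξ'`, and the two sets `±ξ' ≥ γ`, each meeting the sublevel set
  in measure `≤ 2t/γ`; `γ = √(tδ)`); `…_of_second_deriv_le` is the concave twin.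

These are the inputs by which certified quadratures bound the measure of the energy shell
`|ξ(u)| ≤ t` near a simple (order one) or tangential (order two) crossing.

## References
* [CarberyChristWright1999] A. Carbery, M. Christ, J. Wright, *Multidimensional van der Corput and
  sublevel set estimates*, J. Amer. Math. Soc. 12 (1999) 981–1015, §1 (the classical one-dimensional
  estimate `|{x ∈ I : |u| ≤ ε}| ≤ C_k (ε/λ)^{1/k}` for `|u^{(k)}| ≥ λ`).
* [Stein1993] E. M. Stein, *Harmonic Analysis*, Princeton (1993), Ch. VIII §1.2 (van der Corput's
  lemma, the oscillatory form).
* [BrennerThomeeWahlbin1975] P. Brenner, V. Thomée, L. B. Wahlbin, LNM 434 (1975), Ch. 1 §5 (the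
  oscillatory form, `VanDerCorput.lean`).
-/

noncomputable section

open MeasureTheory Set
open scoped ENNReal

namespace Literature.Analysis.Fourier

/-! ### Order one -/

/-- **Derivative-free core.** If `g > 0` and `g·|u - v| ≤ |ξ u - ξ v|` for all `u, v ∈ s`, then the
sublevel set `{u ∈ s : |ξ u| ≤ t}` has diameter, hence Lebesgue measure, at most `2t/g`.
[cite: CarberyChristWright1999, §1] -/
theorem volume_sublevel_le_of_expansive {ξ : ℝ → ℝ} {s : Set ℝ} {g : ℝ} (t : ℝ) (hg : 0 < g)
    (h : ∀ u ∈ s, ∀ v ∈ s, g * |u - v| ≤ |ξ u - ξ v|) :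
    volume {u ∈ s | |ξ u| ≤ t} ≤ ENNReal.ofReal (2 * t / g) := by
  refine (Real.volume_le_diam _).trans (Metric.ediam_le fun u hu v hv => ?_)
  rw [edist_dist, Real.dist_eq]
  apply ENNReal.ofReal_le_ofReal
  have h1 := h u hu.1 v hv.1
  have hu2 := abs_le.1 hu.2
  have hv2 := abs_le.1 hv.2
  have h2 : |ξ u - ξ v| ≤ 2 * t := abs_le.2 ⟨by linarith, by linarith⟩
  rw [le_div_iff₀ hg]
  nlinarith [abs_nonneg (u - v)]

/-- **Order-one sublevel set estimate (increasing case).** If `ξ` is continuous on `[a,b]`,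
differentiable on `(a,b)` with `ξ' ≥ g > 0` there, then `volume {u ∈ [a,b] : |ξ u| ≤ t} ≤ 2t/g`.
[cite: CarberyChristWright1999, §1] -/
theorem volume_sublevel_Icc_le_of_deriv_ge {ξ : ℝ → ℝ} {a b g : ℝ} (t : ℝ) (hg : 0 < g)
    (hcont : ContinuousOn ξ (Icc a b)) (hdiff : DifferentiableOn ℝ ξ (Ioo a b))
    (hge : ∀ x ∈ Ioo a b, g ≤ deriv ξ x) :
    volume {u ∈ Icc a b | |ξ u| ≤ t} ≤ ENNReal.ofReal (2 * t / g) := by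
  apply volume_sublevel_le_of_expansive t hg
  have key := (convex_Icc a b).mul_sub_le_image_sub_of_le_deriv hcont
    (by rwa [interior_Icc]) (by rwa [interior_Icc])
  intro u hu v hv
  rcases le_total u v with huv | hvu
  · have h1 := key u hu v hv huv
    rw [abs_sub_comm u v, abs_of_nonneg (sub_nonneg.2 huv), abs_sub_comm]
    exact h1.trans (le_abs_self _)
  · have h1 := key v hv u hu hvu
    rw [abs_of_nonneg (sub_nonneg.2 hvu)]
    exact h1.trans (le_abs_self _)

/-- **Order-one sublevel set estimate (decreasing case)**: `ξ' ≤ -g < 0` on `(a,b)` gives the same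
bound `volume {u ∈ [a,b] : |ξ u| ≤ t} ≤ 2t/g`. [cite: CarberyChristWright1999, §1] -/
theorem volume_sublevel_Icc_le_of_deriv_le {ξ : ℝ → ℝ} {a b g : ℝ} (t : ℝ) (hg : 0 < g)
    (hcont : ContinuousOn ξ (Icc a b)) (hdiff : DifferentiableOn ℝ ξ (Ioo a b))
    (hle : ∀ x ∈ Ioo a b, deriv ξ x ≤ -g) :
    volume {u ∈ Icc a b | |ξ u| ≤ t} ≤ ENNReal.ofReal (2 * t / g) := by
  have h := volume_sublevel_Icc_le_of_deriv_ge (ξ := -ξ) t hg hcont.neg hdiff.neg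
    (fun x hx => by rw [deriv.neg]; linarith [hle x hx])
  simpa only [Pi.neg_apply, abs_neg] using h

/-! ### Order two -/

/-- Arithmetic of the order-two constant: for `t, δ > 0` and `γ = √(tδ)`,
`2t/γ + 2γ/δ + 2t/γ = 6√(t/δ)`. [folklore] -/
private theorem orderTwo_const {t δ : ℝ} (ht : 0 < t) (hδ : 0 < δ) :
    2 * t / Real.sqrt (t * δ) + 2 * Real.sqrt (t * δ) / δ + 2 * t / Real.sqrt (t * δ)
      = 6 * Real.sqrt (t / δ) := by
  obtain ⟨s, hs, rfl⟩ : ∃ s : ℝ, 0 < s ∧ t = s ^ 2 :=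
    ⟨Real.sqrt t, Real.sqrt_pos.2 ht, (Real.sq_sqrt ht.le).symm⟩
  obtain ⟨r, hr, rfl⟩ : ∃ r : ℝ, 0 < r ∧ δ = r ^ 2 :=
    ⟨Real.sqrt δ, Real.sqrt_pos.2 hδ, (Real.sq_sqrt hδ.le).symm⟩
  rw [Real.sqrt_mul (sq_nonneg s), Real.sqrt_div (sq_nonneg s), Real.sqrt_sq hs.le,
    Real.sqrt_sq hr.le]
  field_simp
  ring

/-- **Order-two sublevel set estimate (convex case).** Let `ξ` have derivative `ξ'` at every point
of `[a,b]`, with `ξ'` continuous on `[a,b]`, differentiable on `(a,b)` and `(ξ')' ≥ δ > 0` there.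
Then for `t > 0`: `volume {u ∈ [a,b] : |ξ u| ≤ t} ≤ 6√(t/δ)`.
Proof: with `γ = √(tδ)`, `[a,b] = {ξ' ≤ -γ} ∪ {|ξ'| ≤ γ} ∪ {ξ' ≥ γ}`; the middle set has measure
`≤ 2γ/δ` (order one for `ξ'`), and on each outer set `ξ` is `γ`-expansive (mean value theorem and
monotonicity of `ξ'`), so it meets the sublevel set in measure `≤ 2t/γ`.
[cite: CarberyChristWright1999, §1] -/
theorem volume_sublevel_Icc_le_of_second_deriv_ge {ξ ξ' : ℝ → ℝ} {a b δ t : ℝ} (ht : 0 < t)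
    (hδ : 0 < δ) (hξ : ∀ x ∈ Icc a b, HasDerivAt ξ (ξ' x) x) (hcont' : ContinuousOn ξ' (Icc a b))
    (hdiff' : DifferentiableOn ℝ ξ' (Ioo a b)) (hge : ∀ x ∈ Ioo a b, δ ≤ deriv ξ' x) :
    volume {u ∈ Icc a b | |ξ u| ≤ t} ≤ ENNReal.ofReal (6 * Real.sqrt (t / δ)) := by
  set γ : ℝ := Real.sqrt (t * δ) with hγ_def
  have hγ : 0 < γ := Real.sqrt_pos.2 (mul_pos ht hδ)
  -- monotonicity of `ξ'` with rate `δ`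
  have key' := (convex_Icc a b).mul_sub_le_image_sub_of_le_deriv hcont'
    (by rwa [interior_Icc]) (by rwa [interior_Icc])
  have hmono : ∀ x ∈ Icc a b, ∀ y ∈ Icc a b, x ≤ y → ξ' x ≤ ξ' y := fun x hx y hy hxy => by
    have := key' x hx y hy hxy
    nlinarith
  -- the mean value theorem for `ξ` on `[u,v] ⊆ [a,b]`
  have hmvt : ∀ u ∈ Icc a b, ∀ v ∈ Icc a b, u < v →
      ∃ w ∈ Ioo u v, ξ v - ξ u = ξ' w * (v - u) := by
    intro u hu v hv huv
    have hsub : Icc u v ⊆ Icc a b := Icc_subset_Icc hu.1 hv.2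
    obtain ⟨w, hw, hw'⟩ := exists_hasDerivAt_eq_slope ξ ξ' huv
      (fun x hx => (hξ x (hsub hx)).continuousAt.continuousWithinAt)
      (fun x hx => hξ x (hsub (Ioo_subset_Icc_self hx)))
    refine ⟨w, hw, ?_⟩
    rw [hw', div_mul_cancel₀ _ (sub_ne_zero.2 (ne_of_gt huv))]
  -- the three pieces
  set L : Set ℝ := {x ∈ Icc a b | ξ' x ≤ -γ} with hL
  set M : Set ℝ := {x ∈ Icc a b | |ξ' x| ≤ γ} with hM
  set R : Set ℝ := {x ∈ Icc a b | γ ≤ ξ' x} with hR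
  have hcover : {u ∈ Icc a b | |ξ u| ≤ t} ⊆ ({u ∈ L | |ξ u| ≤ t} ∪ M) ∪ {u ∈ R | |ξ u| ≤ t} := by
    intro u hu
    by_cases h1 : ξ' u ≤ -γ
    · exact Or.inl (Or.inl ⟨⟨hu.1, h1⟩, hu.2⟩)
    · by_cases h2 : γ ≤ ξ' u
      · exact Or.inr ⟨⟨hu.1, h2⟩, hu.2⟩
      · exact Or.inl (Or.inr ⟨hu.1, abs_le.2 ⟨by linarith, by linarith⟩⟩)
  -- expansiveness of `ξ` on `L` and on `R`
  have hexpL : ∀ u ∈ L, ∀ v ∈ L, γ * |u - v| ≤ |ξ u - ξ v| := by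
    intro u hu v hv
    rcases lt_trichotomy u v with huv | huv | huv
    · obtain ⟨w, hw, e⟩ := hmvt u hu.1 v hv.1 huv
      have hw' : ξ' w ≤ -γ :=
        (hmono w ⟨by linarith [hu.1.1, hw.1], by linarith [hv.1.2, hw.2]⟩ v hv.1 hw.2.le).trans hv.2
      rw [abs_sub_comm (ξ u), e, abs_mul, abs_sub_comm u v, abs_of_pos (sub_pos.2 huv)]
      have : γ ≤ |ξ' w| := by rw [abs_of_nonpos (by linarith)]; linarith
      exact mul_le_mul_of_nonneg_right this (by linarith)
    · subst huv; simp
    · obtain ⟨w, hw, e⟩ := hmvt v hv.1 u hu.1 huv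
      have hw' : ξ' w ≤ -γ :=
        (hmono w ⟨by linarith [hv.1.1, hw.1], by linarith [hu.1.2, hw.2]⟩ u hu.1 hw.2.le).trans hu.2
      rw [e, abs_mul, abs_of_pos (sub_pos.2 huv)]
      have : γ ≤ |ξ' w| := by rw [abs_of_nonpos (by linarith)]; linarith
      exact mul_le_mul_of_nonneg_right this (by linarith)
  have hexpR : ∀ u ∈ R, ∀ v ∈ R, γ * |u - v| ≤ |ξ u - ξ v| := by
    intro u hu v hv
    rcases lt_trichotomy u v with huv | huv | huv
    · obtain ⟨w, hw, e⟩ := hmvt u hu.1 v hv.1 huv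
      have hw' : γ ≤ ξ' w :=
        hu.2.trans (hmono u hu.1 w ⟨by linarith [hu.1.1, hw.1], by linarith [hv.1.2, hw.2]⟩ hw.1.le)
      rw [abs_sub_comm (ξ u), e, abs_mul, abs_sub_comm u v, abs_of_pos (sub_pos.2 huv)]
      have : γ ≤ |ξ' w| := by rw [abs_of_nonneg (by linarith)]; linarith
      exact mul_le_mul_of_nonneg_right this (by linarith)
    · subst huv; simp
    · obtain ⟨w, hw, e⟩ := hmvt v hv.1 u hu.1 huv
      have hw' : γ ≤ ξ' w :=
        hv.2.trans (hmono v hv.1 w ⟨by linarith [hv.1.1, hw.1], by linarith [hu.1.2, hw.2]⟩ hw.1.le)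
      rw [e, abs_mul, abs_of_pos (sub_pos.2 huv)]
      have : γ ≤ |ξ' w| := by rw [abs_of_nonneg (by linarith)]; linarith
      exact mul_le_mul_of_nonneg_right this (by linarith)
  -- expansiveness of `ξ'` on `[a,b]` with rate `δ`
  have hexpM : ∀ u ∈ Icc a b, ∀ v ∈ Icc a b, δ * |u - v| ≤ |ξ' u - ξ' v| := by
    intro u hu v hv
    rcases le_total u v with huv | hvu
    · have h1 := key' u hu v hv huv
      rw [abs_sub_comm u v, abs_of_nonneg (sub_nonneg.2 huv), abs_sub_comm]
      exact h1.trans (le_abs_self _)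
    · have h1 := key' v hv u hu hvu
      rw [abs_of_nonneg (sub_nonneg.2 hvu)]
      exact h1.trans (le_abs_self _)
  have hvolL := volume_sublevel_le_of_expansive t hγ hexpL
  have hvolR := volume_sublevel_le_of_expansive t hγ hexpR
  have hvolM : volume M ≤ ENNReal.ofReal (2 * γ / δ) :=
    volume_sublevel_le_of_expansive (ξ := ξ') (s := Icc a b) γ hδ hexpM
  calc volume {u ∈ Icc a b | |ξ u| ≤ t}
      ≤ volume (({u ∈ L | |ξ u| ≤ t} ∪ M) ∪ {u ∈ R | |ξ u| ≤ t}) := measure_mono hcover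
    _ ≤ volume ({u ∈ L | |ξ u| ≤ t} ∪ M) + volume {u ∈ R | |ξ u| ≤ t} := measure_union_le _ _
    _ ≤ (volume {u ∈ L | |ξ u| ≤ t} + volume M) + volume {u ∈ R | |ξ u| ≤ t} := by
        gcongr; exact measure_union_le _ _
    _ ≤ (ENNReal.ofReal (2 * t / γ) + ENNReal.ofReal (2 * γ / δ)) + ENNReal.ofReal (2 * t / γ) := by
        gcongr
    _ = ENNReal.ofReal (6 * Real.sqrt (t / δ)) := by
        rw [← ENNReal.ofReal_add (by positivity) (by positivity),
          ← ENNReal.ofReal_add (by positivity) (by positivity), hγ_def, orderTwo_const ht hδ]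

/-- **Order-two sublevel set estimate (concave case)**: `(ξ')' ≤ -δ < 0` on `(a,b)` gives the same
bound `volume {u ∈ [a,b] : |ξ u| ≤ t} ≤ 6√(t/δ)` (`t > 0`). [cite: CarberyChristWright1999, §1] -/
theorem volume_sublevel_Icc_le_of_second_deriv_le {ξ ξ' : ℝ → ℝ} {a b δ t : ℝ} (ht : 0 < t)
    (hδ : 0 < δ) (hξ : ∀ x ∈ Icc a b, HasDerivAt ξ (ξ' x) x) (hcont' : ContinuousOn ξ' (Icc a b))
    (hdiff' : DifferentiableOn ℝ ξ' (Ioo a b)) (hle : ∀ x ∈ Ioo a b, deriv ξ' x ≤ -δ) :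
    volume {u ∈ Icc a b | |ξ u| ≤ t} ≤ ENNReal.ofReal (6 * Real.sqrt (t / δ)) := by
  have h := volume_sublevel_Icc_le_of_second_deriv_ge (ξ := -ξ) (ξ' := -ξ')
    ht hδ (fun x hx => by simpa using (hξ x hx).neg) hcont'.neg hdiff'.neg
    (fun x hx => by rw [deriv.neg]; linarith [hle x hx])
  simpa only [Pi.neg_apply, abs_neg] using h

end Literature.Analysis.Fourier

end
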